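import Literature.Topology.FourManifolds.HomotopySpheresGroupProofs
import Literature.Topology.FourManifolds.OrientedConnectedSumSphereSelfProofs
import Literature.Topology.FourManifolds.OrientedConnectedSumUniqueness
import Literature.Topology.FourManifolds.OrientedConnectedSumAssoc
import Literature.Topology.FourManifolds.HomotopySpheresSum
import Literature.Topology.FourManifolds.HomotopySpheresSumProofs
import Literature.Topology.FourManifolds.HomotopySpheresInverse
import Literature.AlgebraicTopology.Homotopy.BallComplementRetract
import HarnessLib

/-!
# The group `Θₙ`: Kervaire–Milnor's Theorem 1.1 from the six remaining named facts

Sibling proofs file of `HomotopySpheresGroup.lean` / `HomotopySpheresGroupProofs.lean` (the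
decomposition of the named fact `Literature.Topology.FourManifolds.exists_commGroup_homotopySphereClass`, Kervaire–Milnor's
Theorem 1.1 for the oriented-diffeomorphism classes of homotopy spheres, Ann. of Math. 77 (1963)).
Of the manifold-level inputs of `exists_commGroup_homotopySphereClass_of_manifoldFacts`, two are
theorems of the tree: (ii) existence of oriented connected sums
(`Literature.Topology.FourManifolds.exists_isOrientedConnectedSum_holds`, already fed in there) and (vi) `M # Sⁿ = M` for
oriented connected sums (`Literature.Topology.FourManifolds.isOrientedConnectedSum_sphere_self_holds`,
`OrientedConnectedSumSphereSelfProofs.lean`), which is fed in here: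

* `HomotopySphereClass.isMul_sphere` — `[𝕊ⁿ, o]` is a right unit of `Θₙ`, `n ≠ 0`, for every
  orientation `o` of the sphere (PROVED; Kervaire–Milnor 1963, Lemma 2.1);
* `HomotopySphereClass.groupLawFacts_of_remainingFacts` and
  `Literature.Topology.FourManifolds.exists_commGroup_homotopySphereClass_of_remainingFacts` — **Theorem 1.1 for `Θₙ`,
  `n ≠ 0, 4`, from the six remaining named facts**: (i) the smooth Poincaré conjecture in
  dimensions `≤ 3` (`SPC4.nonemptyDiffeomorphSphere_of_mem`, spc4.S32; p. 507 + Perelman),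
  (iii) sums of homotopy spheres are homotopy spheres
  (`HomotopySphere.nonempty_homotopyEquiv_sphere_of_isConnectedSum`, p. 505), (iv) Palais–Cerf
  uniqueness of oriented connected sums
  (`exists_diffeomorph_isOrientationPreserving_of_isOrientedConnectedSum`, Lemma 2.1),
  (v) associativity (`isOrientedConnectedSum_assoc`, Lemma 2.1), (vii) `Σ # (-Σ) ∼ₕ Sⁿ`
  (`HomotopySphere.isHCobordant_sphere_of_isOrientedConnectedSum_neg`, Lemmas 2.3–2.4),
  (viii) the smooth h-cobordism theorem (`SPC4.nonempty_diffeomorph_of_isHCobordant_of_five_le`,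
  spc4.S15; p. 505).

## References

* M. Kervaire, J. Milnor, *Groups of homotopy spheres I*, Ann. of Math. (2) 77 (1963), Thm 1.1,
  §2 pp. 505–507. [KervaireMilnorAnnals1963]

## Appendix (Palais–Cerf uniqueness fed in)

With `OrientedConnectedSumUniqueness.lean` in the tree, the Palais–Cerf uniqueness of oriented
connected sums of homotopy spheres (input (iv)) is the theorem
`Literature.Topology.FourManifolds.HomotopySphere.exists_diffeomorph_isOrientationPreserving_of_isOrientedConnectedSum`, and
`Literature.Topology.FourManifolds.exists_commGroup_homotopySphereClass_of_fiveFacts` derives Kervaire–Milnor's Theorem 1.1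
for `Θₙ`, `n ≠ 0, 4`, from the FIVE remaining named facts (i) spc4.S32, (iii) K1 (sums of
homotopy spheres are homotopy spheres), (v) K2 (associativity), (vii) K4 (`Σ # (-Σ) ∼ₕ Sⁿ`),
(viii) spc4.S15 (h-cobordism theorem).

## Appendix 2 (associativity fed in)

With `OrientedConnectedSumAssoc.lean` in the tree (`Literature.Topology.FourManifolds.isOrientedConnectedSum_assoc_holds`,
Kervaire–Milnor's Lemma 2.1 "associative", input (v)), the class-level named fact
`Literature.Topology.FourManifolds.HomotopySphereClass.isMul_assoc` of `HomotopySpheresGroup.lean` is DISCHARGED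
(`Literature.Topology.FourManifolds.HomotopySphereClass.isMul_assoc_holds`, via `isMul_assoc_of`), and
`Literature.Topology.FourManifolds.exists_commGroup_homotopySphereClass_of_fourFacts` derives Theorem 1.1 for `Θₙ`, `n ≠ 0, 4`,
from the FOUR remaining named facts (i) spc4.S32 (smooth Poincaré conjecture in dimensions
`≤ 3`, Perelman), (iii) K1 (sums of homotopy spheres are homotopy spheres, p. 505), (vii) K4
(`Σ # (-Σ) ∼ₕ Sⁿ`, Lemmas 2.3–2.4), (viii) spc4.S15 (Smale's h-cobordism theorem) — i.e. exactly
the homotopy-theoretic and cobordism-theoretic inputs of the printed proof; all the differential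
topology of §2 (existence, uniqueness, unit, associativity of oriented connected sums) is proved.
Finally, with the reduction of K1 to the contractibility of punctured homotopy spheres
(`HomotopySpheresSum.lean`, `Literature.Topology.FourManifolds.HomotopySphere.nonempty_homotopyEquiv_sphere_of_isConnectedSum_of`),
`Literature.Topology.FourManifolds.exists_commGroup_homotopySphereClass_of_fourFacts'` takes in place of K1 the named fact
`Literature.Topology.FourManifolds.HomotopySphere.contractibleSpace_compl_image_ball` (Kosinski VI §1; Kervaire–Milnor p. 507).

## Appendix 3 (the current leaves)

The Palais–Cerf uniqueness being a theorem for manifolds modelled on `ℝⁿ`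
(`Literature.Topology.FourManifolds.exists_diffeomorph_isOrientationPreserving_of_isOrientedConnectedSum_euclidean_holds`), the
hypothesis `hPC` of the reduction
`Literature.Topology.FourManifolds.HomotopySphere.boundsContractible_of_isOrientedConnectedSum_neg_of_exists`
(`HomotopySpheresInverse.lean`, Kervaire–Milnor's Lemma 2.4 read with Lemma 2.1) is discharged
(`…_of_exists'`), and the contractibility of `Σ ∖ {p}`
(`Literature.Topology.FourManifolds.HomotopySphere.contractibleSpace_compl_singleton`) follows from that of `Σ ∖ i(B̊ⁿ)`
(`Literature.Topology.FourManifolds.HomotopySphere.contractibleSpace_compl_image_ball`) by the deformation retraction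
`Literature.AlgebraicTopology.Homotopy.BallComplement.homotopyEquiv`. Hence `Literature.Topology.FourManifolds.exists_commGroup_homotopySphereClass_of_leaves`:
Theorem 1.1 for `Θₙ`, `n ≠ 0, 4`, follows from SIX named facts, none of which concerns the
connected sum operation itself — (i) `SPC4.nonemptyDiffeomorphSphere_of_mem` (spc4.S32: smooth
Poincaré conjecture in dimensions `≤ 3`; Perelman), (iii') `contractibleSpace_compl_image_ball`
(Whitehead's theorem; Kosinski VI §1), (vii-a) `NullCobordism.exists_cobordism_sphere_compl_ball`
and (vii-c) `HomotopySphere.exists_nullCobordism_isOrientedConnectedSum_neg` (the two smooth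
constructions WITH BOUNDARY in the proofs of Lemmas 2.3 and 2.4, pp. 506–507), (vii-b)
`NullCobordism.isHomotopyEquiv_compl_ball_of_contractibleSpace` (excision, Poincaré–Lefschetz
duality, Whitehead; proof of Lemma 2.3) and (viii) `SPC4.nonempty_diffeomorph_of_isHCobordant_of_five_le`
(spc4.S15: Smale's h-cobordism theorem). With the reduction of (iii') to the Whitehead–Hurewicz
recognition principle and spc4.S32 (`HomotopySpheresSumProofs.lean`,
`Literature.Topology.FourManifolds.HomotopySphere.contractibleSpace_compl_image_ball_of_facts`),
`Literature.Topology.FourManifolds.exists_commGroup_homotopySphereClass_of_leaves'` takes in place of (iii') the named fact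
`Literature.AlgebraicTopology.Homotopy.Manifold.contractibleSpace_of_simplyConnected_of_acyclic` (Bredon 1993, VII Cor. 10.11 +
Milnor 1959, Cor. 1).
-/

open scoped Manifold ContDiff Topology ContinuousMap
open Set Module

noncomputable section

namespace Literature.Topology.FourManifolds

namespace HomotopySphereClass

variable {n : ℕ}

/-- **`[𝕊ⁿ, o]` is a right unit of `Θₙ`** for every orientation `o` of `𝕊ⁿ`, `n ≠ 0` (PROVED:
`isMul_sphere_of` fed with the theorem `isOrientedConnectedSum_sphere_self_holds`; Kervaire–Milnor
1963, Lemma 2.1: "The sphere `Sⁿ` serves as identity element"). [cite: KervaireMilnorAnnals1963, Lemma 2.1 (p. 505)] -/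
theorem isMul_sphere (hn : n ≠ 0)
    (o : SmoothOrientation (𝓡 n) (Metric.sphere (0 : EuclideanSpace ℝ (Fin (n + 1))) 1))
    (a : HomotopySphereClass n) : IsMul a (mk (HomotopySphere.sphere o)) a :=
  isMul_sphere_of isOrientedConnectedSum_sphere_self_holds hn o a

/-- **`GroupLawFacts n`, `n ≥ 5`, from the six remaining named facts** (Kervaire–Milnor 1963,
§2): sums of homotopy spheres are homotopy spheres (p. 505), Palais–Cerf uniqueness and
associativity of `#` (Lemma 2.1), `Σ # (-Σ) ∼ₕ Sⁿ` (Lemmas 2.3–2.4) and Smale's h-cobordism theorem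
(spc4.S15); existence of oriented connected sums and `M # Sⁿ = M` being the theorems
`exists_isOrientedConnectedSum_holds` and `isOrientedConnectedSum_sphere_self_holds`.
[cite: KervaireMilnorAnnals1963, §2 (Lemmas 2.1–2.4, pp. 505–507)] -/
theorem groupLawFacts_of_remainingFacts (h5 : 5 ≤ n)
    (hK1 : HomotopySphere.nonempty_homotopyEquiv_sphere_of_isConnectedSum)
    (hPC : ∀ S T U U' : HomotopySphere n,
      exists_diffeomorph_isOrientationPreserving_of_isOrientedConnectedSum (IM := 𝓡 n)
        (IN := 𝓡 n) (IP := 𝓡 n) (IP' := 𝓡 n) (M := S.carrier) (N := T.carrier)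
        (P := U.carrier) (P' := U'.carrier))
    (hK2 : isOrientedConnectedSum_assoc.{0})
    (hK4 : HomotopySphere.isHCobordant_sphere_of_isOrientedConnectedSum_neg)
    (hS15 : FourManifolds.nonempty_diffeomorph_of_isHCobordant_of_five_le.{0}) :
    GroupLawFacts n :=
  groupLawFacts_of_manifoldFacts h5 hK1 hPC hK2 isOrientedConnectedSum_sphere_self_holds hK4 hS15

end HomotopySphereClass

/-- **Kervaire–Milnor's Theorem 1.1 for `Θₙ = HomotopySphereClass n`, `n ≠ 0, 4`, from the six
remaining named facts**: (i) the smooth Poincaré conjecture in dimensions `1, 2, 3`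
(`SPC4.nonemptyDiffeomorphSphere_of_mem`, spc4.S32; Kervaire–Milnor p. 507 + Perelman),
(iii) sums of homotopy spheres are homotopy spheres (p. 505), (iv) Palais–Cerf uniqueness of
oriented connected sums (Lemma 2.1), (v) associativity (Lemma 2.1), (vii) `Σ # (-Σ) ∼ₕ Sⁿ`
(Lemmas 2.3–2.4), (viii) the smooth h-cobordism theorem (spc4.S15; p. 505). The other two inputs
of the printed proof, (ii) existence of oriented connected sums and (vi) `M # Sⁿ = M`, are the
theorems `exists_isOrientedConnectedSum_holds` and `isOrientedConnectedSum_sphere_self_holds`.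
[cite: KervaireMilnorAnnals1963, Thm. 1.1, §2 pp. 505–507] -/
theorem exists_commGroup_homotopySphereClass_of_remainingFacts
    (hlow : FourManifolds.nonemptyDiffeomorphSphere_of_mem.{0})
    (hK1 : HomotopySphere.nonempty_homotopyEquiv_sphere_of_isConnectedSum)
    (hPC : ∀ (n : ℕ) (S T U U' : HomotopySphere n),
      exists_diffeomorph_isOrientationPreserving_of_isOrientedConnectedSum (IM := 𝓡 n)
        (IN := 𝓡 n) (IP := 𝓡 n) (IP' := 𝓡 n) (M := S.carrier) (N := T.carrier)
        (P := U.carrier) (P' := U'.carrier))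
    (hK2 : isOrientedConnectedSum_assoc.{0})
    (hK4 : HomotopySphere.isHCobordant_sphere_of_isOrientedConnectedSum_neg)
    (hS15 : FourManifolds.nonempty_diffeomorph_of_isHCobordant_of_five_le.{0}) :
    exists_commGroup_homotopySphereClass :=
  exists_commGroup_homotopySphereClass_of_manifoldFacts hlow hK1 hPC hK2
    isOrientedConnectedSum_sphere_self_holds hK4 hS15


/-! ### Appendix: Palais–Cerf uniqueness fed in (five remaining facts) -/

namespace HomotopySphere

/-- **Palais–Cerf uniqueness for homotopy spheres** (PROVED): the instance of the named fact
`exists_diffeomorph_isOrientationPreserving_of_isOrientedConnectedSum` for the carriers of four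
homotopy `n`-spheres, from the Euclidean-model theorem
`exists_diffeomorph_isOrientationPreserving_of_isOrientedConnectedSum_euclidean`
(`OrientedConnectedSumUniqueness.lean`; Kervaire–Milnor 1963, Lemma 2.1 "well defined", via the
oriented disc theorem of Palais and Cerf). [cite: KervaireMilnorAnnals1963, Lemma 2.1 (p. 505)] -/
theorem exists_diffeomorph_isOrientationPreserving_of_isOrientedConnectedSum {n : ℕ}
    (S T U U' : HomotopySphere n) :
    Literature.Topology.FourManifolds.exists_diffeomorph_isOrientationPreserving_of_isOrientedConnectedSum (IM := 𝓡 n)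
      (IN := 𝓡 n) (IP := 𝓡 n) (IP' := 𝓡 n) (M := S.carrier) (N := T.carrier)
      (P := U.carrier) (P' := U'.carrier) := by
  intro _ _ _ _ oM oN oP oP' h h'
  exact exists_diffeomorph_isOrientationPreserving_of_isOrientedConnectedSum_euclidean h h'

end HomotopySphere

namespace HomotopySphereClass

variable {n : ℕ}

/-- **`GroupLawFacts n`, `n ≥ 5`, from the five remaining named facts** (Kervaire–Milnor 1963,
§2): K1 (sums of homotopy spheres are homotopy spheres, p. 505), K2 (associativity, Lemma 2.1),
K4 (`Σ # (-Σ) ∼ₕ Sⁿ`, Lemmas 2.3–2.4) and Smale's h-cobordism theorem (spc4.S15); existence of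
oriented connected sums, `M # Sⁿ = M` and Palais–Cerf uniqueness being theorems.
[cite: KervaireMilnorAnnals1963, §2 (Lemmas 2.1–2.4, pp. 505–507)] -/
theorem groupLawFacts_of_fiveFacts (h5 : 5 ≤ n)
    (hK1 : HomotopySphere.nonempty_homotopyEquiv_sphere_of_isConnectedSum)
    (hK2 : isOrientedConnectedSum_assoc.{0})
    (hK4 : HomotopySphere.isHCobordant_sphere_of_isOrientedConnectedSum_neg)
    (hS15 : FourManifolds.nonempty_diffeomorph_of_isHCobordant_of_five_le.{0}) :
    GroupLawFacts n :=
  groupLawFacts_of_remainingFacts h5 hK1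
    HomotopySphere.exists_diffeomorph_isOrientationPreserving_of_isOrientedConnectedSum hK2 hK4 hS15

end HomotopySphereClass

/-- **Kervaire–Milnor's Theorem 1.1 for `Θₙ = HomotopySphereClass n`, `n ≠ 0, 4`, from the FIVE
remaining named facts**: (i) the smooth Poincaré conjecture in dimensions `1, 2, 3`
(`SPC4.nonemptyDiffeomorphSphere_of_mem`, spc4.S32; p. 507 + Perelman), (iii) sums of homotopy
spheres are homotopy spheres (`HomotopySphere.nonempty_homotopyEquiv_sphere_of_isConnectedSum`,
p. 505), (v) associativity of the oriented connected sum (`isOrientedConnectedSum_assoc`,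
Lemma 2.1), (vii) `Σ # (-Σ)` is h-cobordant to `Sⁿ`
(`HomotopySphere.isHCobordant_sphere_of_isOrientedConnectedSum_neg`, Lemmas 2.3–2.4), (viii) the
smooth h-cobordism theorem (`SPC4.nonempty_diffeomorph_of_isHCobordant_of_five_le`, spc4.S15).
The other inputs of the printed proof — (ii) existence of oriented connected sums, (iv) their
uniqueness (Palais–Cerf) and (vi) `M # Sⁿ = M` — are theorems of the tree
(`exists_isOrientedConnectedSum_holds`,
`exists_diffeomorph_isOrientationPreserving_of_isOrientedConnectedSum_euclidean`,
`isOrientedConnectedSum_sphere_self_holds`). [cite: KervaireMilnorAnnals1963, Thm. 1.1, §2 pp. 505–507] -/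
theorem exists_commGroup_homotopySphereClass_of_fiveFacts
    (hlow : FourManifolds.nonemptyDiffeomorphSphere_of_mem.{0})
    (hK1 : HomotopySphere.nonempty_homotopyEquiv_sphere_of_isConnectedSum)
    (hK2 : isOrientedConnectedSum_assoc.{0})
    (hK4 : HomotopySphere.isHCobordant_sphere_of_isOrientedConnectedSum_neg)
    (hS15 : FourManifolds.nonempty_diffeomorph_of_isHCobordant_of_five_le.{0}) :
    exists_commGroup_homotopySphereClass :=
  exists_commGroup_homotopySphereClass_of_groupLawFacts hlow fun _ h5 =>
    HomotopySphereClass.groupLawFacts_of_fiveFacts h5 hK1 hK2 hK4 hS15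

/-! ### Appendix 2: associativity fed in (four remaining facts) -/

namespace HomotopySphereClass

section

variable {n : ℕ}

/-- **Discharge of the named fact `HomotopySphereClass.isMul_assoc`: the group law of `Θₙ` is
associative** (Kervaire–Milnor, *Groups of homotopy spheres I*, Ann. of Math. 77 (1963),
Lemma 2.1, p. 505: "The connected sum operation is well defined, associative, and commutative up
to orientation preserving diffeomorphism"; proof there by the disc lemma of Palais and Cerf). For
`n ≠ 0`, if `a # b = ab`, `b # c = bc`, `ab # c = d` and `a # bc = d'` in the sense of `IsMul`,
then `d = d'`. PROVED: the reduction `isMul_assoc_of` (`HomotopySpheresGroupProofs.lean`: transport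
the four witnesses to common representatives along oriented diffeomorphisms,
`IsMul.exists_isOrientedConnectedSum_of_mk_eq`) fed with the manifold-level associativity THEOREM
`isOrientedConnectedSum_assoc_holds` (`OrientedConnectedSumAssoc.lean`: `(M₁ # M₂) # M₃ ≅ M₁ # (M₂ # M₃)`
by an orientation-preserving diffeomorphism, for closed connected oriented `n`-manifolds, via the
Palais–Cerf uniqueness of oriented connected sums and Kosinski's gluing, *Differential Manifolds*
(1993), Ch. VI §1). The dimension `n` is the named fact's own implicit parameter (section
variable), as for `mk_sphere_eq_holds`. [cite: KervaireMilnorAnnals1963, Lemma 2.1 (p. 505)] -/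
theorem isMul_assoc_holds : isMul_assoc (n := n) :=
  isMul_assoc_of isOrientedConnectedSum_assoc_holds.{0}

end

/-- **`GroupLawFacts n`, `n ≥ 5`, from the four remaining named facts** (Kervaire–Milnor 1963,
§2): K1 (sums of homotopy spheres are homotopy spheres, p. 505), K4 (`Σ # (-Σ) ∼ₕ Sⁿ`,
Lemmas 2.3–2.4) and Smale's h-cobordism theorem (spc4.S15); existence, uniqueness (Palais–Cerf),
unit `M # Sⁿ = M` and associativity of oriented connected sums being theorems of the tree.
[cite: KervaireMilnorAnnals1963, §2 (Lemmas 2.1–2.4, pp. 505–507)] -/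
theorem groupLawFacts_of_fourFacts {n : ℕ} (h5 : 5 ≤ n)
    (hK1 : HomotopySphere.nonempty_homotopyEquiv_sphere_of_isConnectedSum)
    (hK4 : HomotopySphere.isHCobordant_sphere_of_isOrientedConnectedSum_neg)
    (hS15 : FourManifolds.nonempty_diffeomorph_of_isHCobordant_of_five_le.{0}) :
    GroupLawFacts n :=
  groupLawFacts_of_fiveFacts h5 hK1 isOrientedConnectedSum_assoc_holds.{0} hK4 hS15

end HomotopySphereClass

/-- **Kervaire–Milnor's Theorem 1.1 for `Θₙ = HomotopySphereClass n`, `n ≠ 0, 4`, from the FOUR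
remaining named facts**: (i) the smooth Poincaré conjecture in dimensions `1, 2, 3`
(`SPC4.nonemptyDiffeomorphSphere_of_mem`, spc4.S32; p. 507 + Perelman), (iii) sums of homotopy
spheres are homotopy spheres (`HomotopySphere.nonempty_homotopyEquiv_sphere_of_isConnectedSum`,
p. 505), (vii) `Σ # (-Σ)` is h-cobordant to `Sⁿ`
(`HomotopySphere.isHCobordant_sphere_of_isOrientedConnectedSum_neg`, Lemmas 2.3–2.4), (viii) the
smooth h-cobordism theorem (`SPC4.nonempty_diffeomorph_of_isHCobordant_of_five_le`, spc4.S15).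
The differential-topological inputs of the printed proof — (ii) existence of oriented connected
sums, (iv) their uniqueness (Palais–Cerf), (v) associativity and (vi) `M # Sⁿ = M` (Lemma 2.1) —
are theorems of the tree (`exists_isOrientedConnectedSum_holds`,
`exists_diffeomorph_isOrientationPreserving_of_isOrientedConnectedSum_euclidean`,
`isOrientedConnectedSum_assoc_holds`, `isOrientedConnectedSum_sphere_self_holds`). [cite: KervaireMilnorAnnals1963, Thm. 1.1, §2 pp. 505–507] -/
theorem exists_commGroup_homotopySphereClass_of_fourFacts
    (hlow : FourManifolds.nonemptyDiffeomorphSphere_of_mem.{0})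
    (hK1 : HomotopySphere.nonempty_homotopyEquiv_sphere_of_isConnectedSum)
    (hK4 : HomotopySphere.isHCobordant_sphere_of_isOrientedConnectedSum_neg)
    (hS15 : FourManifolds.nonempty_diffeomorph_of_isHCobordant_of_five_le.{0}) :
    exists_commGroup_homotopySphereClass :=
  exists_commGroup_homotopySphereClass_of_groupLawFacts hlow fun _ h5 =>
    HomotopySphereClass.groupLawFacts_of_fourFacts h5 hK1 hK4 hS15

/-- **Theorem 1.1 for `Θₙ`, `n ≠ 0, 4`, from four named facts, K1 replaced by the
contractibility of punctured homotopy spheres**: (i) `SPC4.nonemptyDiffeomorphSphere_of_mem`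
(spc4.S32), (iii') `HomotopySphere.contractibleSpace_compl_image_ball` (a homotopy sphere with an
open disc deleted is contractible; Kosinski VI §1, Kervaire–Milnor p. 507), which implies K1 by
`HomotopySphere.nonempty_homotopyEquiv_sphere_of_isConnectedSum_of` (`HomotopySpheresSum.lean`),
(vii) `HomotopySphere.isHCobordant_sphere_of_isOrientedConnectedSum_neg` (Lemmas 2.3–2.4),
(viii) `SPC4.nonempty_diffeomorph_of_isHCobordant_of_five_le` (spc4.S15). [cite: KervaireMilnorAnnals1963, Thm. 1.1, §2 pp. 505–507] -/
theorem exists_commGroup_homotopySphereClass_of_fourFacts'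
    (hlow : FourManifolds.nonemptyDiffeomorphSphere_of_mem.{0})
    (hKball : HomotopySphere.contractibleSpace_compl_image_ball)
    (hK4 : HomotopySphere.isHCobordant_sphere_of_isOrientedConnectedSum_neg)
    (hS15 : FourManifolds.nonempty_diffeomorph_of_isHCobordant_of_five_le.{0}) :
    exists_commGroup_homotopySphereClass :=
  exists_commGroup_homotopySphereClass_of_fourFacts hlow
    (HomotopySphere.nonempty_homotopyEquiv_sphere_of_isConnectedSum_of hKball) hK4 hS15

/-! ### Appendix 3: Palais–Cerf fed into Lemma 2.4; the current leaves -/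

/-- **The named fact `exists_diffeomorph_isOrientationPreserving_of_isOrientedConnectedSum` holds
for manifolds modelled on `ℝⁿ`** (PROVED: this is the theorem
`exists_diffeomorph_isOrientationPreserving_of_isOrientedConnectedSum_euclidean` of
`OrientedConnectedSumUniqueness.lean`, restated as an instance of the named fact of
`ConnectedSum.lean`; Kervaire–Milnor 1963, Lemma 2.1 "well defined … up to orientation preserving
diffeomorphism", via the disc theorem of Palais and Cerf). [cite: KervaireMilnorAnnals1963, Lemma 2.1 (p. 505)] -/
theorem exists_diffeomorph_isOrientationPreserving_of_isOrientedConnectedSum_euclidean_holds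
    {n : ℕ} {M N P P' : Type*}
    [TopologicalSpace M] [T2Space M] [ChartedSpace (EuclideanSpace ℝ (Fin n)) M]
    [IsManifold (𝓡 n) ∞ M]
    [TopologicalSpace N] [T2Space N] [ChartedSpace (EuclideanSpace ℝ (Fin n)) N]
    [IsManifold (𝓡 n) ∞ N]
    [TopologicalSpace P] [ChartedSpace (EuclideanSpace ℝ (Fin n)) P] [IsManifold (𝓡 n) ∞ P]
    [TopologicalSpace P'] [ChartedSpace (EuclideanSpace ℝ (Fin n)) P'] [IsManifold (𝓡 n) ∞ P'] :
    Literature.Topology.FourManifolds.exists_diffeomorph_isOrientationPreserving_of_isOrientedConnectedSum (IM := 𝓡 n)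
      (IN := 𝓡 n) (IP := 𝓡 n) (IP' := 𝓡 n) (M := M) (N := N) (P := P) (P' := P') := by
  intro _ _ _ _ oM oN oP oP' h h'
  exact exists_diffeomorph_isOrientationPreserving_of_isOrientedConnectedSum_euclidean h h'

/-- **Kervaire–Milnor's Lemma 2.4 for every sum from the existential Lemma 2.4** (PROVED
reduction, the Palais–Cerf hypothesis `hPC` of
`HomotopySphere.boundsContractible_of_isOrientedConnectedSum_neg_of_exists` being the theorem
`exists_diffeomorph_isOrientationPreserving_of_isOrientedConnectedSum_euclidean_holds`): if for
every homotopy `n`-sphere `Σ`, `n ≥ 2`, SOME oriented connected sum `Σ # (-Σ)` bounds a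
contractible manifold (Lemma 2.4 as constructed, p. 507), then EVERY oriented connected sum
`Σ # (-Σ)` does (Lemma 2.4 as used, read with Lemma 2.1).
[cite: KervaireMilnorAnnals1963, Lemmas 2.1 and 2.4 (pp. 505, 507)] -/
theorem HomotopySphere.boundsContractible_of_isOrientedConnectedSum_neg_of_exists'
    (h24 : HomotopySphere.exists_isOrientedConnectedSum_neg_boundsContractible) :
    HomotopySphere.boundsContractible_of_isOrientedConnectedSum_neg :=
  HomotopySphere.boundsContractible_of_isOrientedConnectedSum_neg_of_exists h24
    fun _ _ _ _ _ _ _ _ _ _ _ _ _ _ _ _ =>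
      exists_diffeomorph_isOrientationPreserving_of_isOrientedConnectedSum_euclidean_holds

/-- **`Σ ∖ {p}` is contractible if `Σ ∖ i(B̊ⁿ)` is** (PROVED reduction between the two named
facts `HomotopySphere.contractibleSpace_compl_image_ball` (`HomotopySpheresSum.lean`) and
`HomotopySphere.contractibleSpace_compl_singleton` (`HomotopySpheresInverse.lean`)): take a disc
`i = e⁻¹` centred at `p` from a chart `e` onto `ℝⁿ` with `e p = 0`
(`exists_mem_maximalAtlas_target_eq_univ`); the complement of `i(B̊ⁿ)` is a deformation retract of
`Σ ∖ {i 0}` (`BallComplement.homotopyEquiv`), and contractibility is a homotopy invariant.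
(Kervaire–Milnor 1963, proof of Lemma 2.4, p. 507: "`W` contains `M - Interior i(½Dⁿ)` as
deformation retract, and therefore is contractible".) [cite: KervaireMilnorAnnals1963, Lemma 2.4, proof (p. 507)] -/
theorem HomotopySphere.contractibleSpace_compl_singleton_of_compl_image_ball
    (hK : HomotopySphere.contractibleSpace_compl_image_ball) :
    HomotopySphere.contractibleSpace_compl_singleton := by
  intro n S p _
  obtain ⟨e, he, hpe, het, hep⟩ :=
    exists_mem_maximalAtlas_target_eq_univ (E := EuclideanSpace ℝ (Fin n)) (M := S.carrier) p
  have hi : Manifold.IsSmoothEmbedding 𝓘(ℝ, EuclideanSpace ℝ (Fin n)) (𝓡 n) ∞ e.symm :=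
    isSmoothEmbedding_symm_of_target_eq_univ he het
  have hio : Topology.IsOpenEmbedding e.symm := e.symm.to_isOpenEmbedding (by simp [het])
  have hi0 : e.symm 0 = p := by rw [← hep]; exact e.left_inv hpe
  haveI := hK n S e.symm hi
  haveI : ContractibleSpace ↥(({e.symm 0}ᶜ : Set S.carrier)) :=
    (Literature.AlgebraicTopology.Homotopy.BallComplement.homotopyEquiv hio).symm.contractibleSpace
  rw [hi0] at this
  exact this

/-- **Kervaire–Milnor's Theorem 1.1 for `Θₙ = HomotopySphereClass n`, `n ≠ 0, 4`, from the current
leaves of the decomposition** — six named facts, none of which concerns the connected sum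
operation itself: (i) the smooth Poincaré conjecture in dimensions `≤ 3`
(`SPC4.nonemptyDiffeomorphSphere_of_mem`, spc4.S32; Kervaire–Milnor p. 507 + Perelman);
(iii') a homotopy sphere with an open disc deleted is contractible
(`HomotopySphere.contractibleSpace_compl_image_ball`; Whitehead's theorem), which gives both the
p. 505 remark "the sum of two homotopy spheres is a homotopy sphere"
(`HomotopySphere.nonempty_homotopyEquiv_sphere_of_isConnectedSum_of`, `HomotopySpheresSum.lean`) and
the contractibility half of Lemma 2.4 (`HomotopySphere.contractibleSpace_compl_singleton_of_compl_image_ball`);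
(vii-a) removing an open ball from a null-cobordism gives a cobordism to `Sⁿ`
(`NullCobordism.exists_cobordism_sphere_compl_ball`, proof of Lemma 2.3) and (vii-b) its homotopy
theory (`NullCobordism.isHomotopyEquiv_compl_ball_of_contractibleSpace`: excision, Poincaré
duality, Whitehead; proof of Lemma 2.3); (vii-c) Kervaire–Milnor's rotation construction
(`HomotopySphere.exists_nullCobordism_isOrientedConnectedSum_neg`, proof of Lemma 2.4); (viii)
Smale's h-cobordism theorem (`SPC4.nonempty_diffeomorph_of_isHCobordant_of_five_le`, spc4.S15).
Everything else in the printed proof of Theorem 1.1 (§2, pp. 504–507) — existence, uniqueness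
(Palais–Cerf), unit, associativity and commutativity of oriented connected sums, the passage
from Lemmas 2.3–2.4 to inverses, `Θₙ` for `n ≤ 3` from the Poincaré conjecture — is proved in
the tree (`HomotopySpheresGroup*.lean`, `OrientedConnectedSum*.lean`, `HomotopySpheresInverse.lean`).
[cite: KervaireMilnorAnnals1963, Thm. 1.1, §2 pp. 504–507] -/
theorem exists_commGroup_homotopySphereClass_of_leaves
    (hlow : FourManifolds.nonemptyDiffeomorphSphere_of_mem.{0})
    (hKball : HomotopySphere.contractibleSpace_compl_image_ball)
    (h23a : NullCobordism.exists_cobordism_sphere_compl_ball)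
    (h23b : NullCobordism.isHomotopyEquiv_compl_ball_of_contractibleSpace)
    (h24a : HomotopySphere.exists_nullCobordism_isOrientedConnectedSum_neg)
    (hS15 : FourManifolds.nonempty_diffeomorph_of_isHCobordant_of_five_le.{0}) :
    exists_commGroup_homotopySphereClass :=
  exists_commGroup_homotopySphereClass_of_fourFacts' hlow hKball
    (HomotopySphere.isHCobordant_sphere_of_isOrientedConnectedSum_neg_of
      (isHCobordant_sphere_of_boundsContractible_of h23a h23b)
      (HomotopySphere.boundsContractible_of_isOrientedConnectedSum_neg_of_exists'
        (HomotopySphere.exists_isOrientedConnectedSum_neg_boundsContractible_of h24a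
          (HomotopySphere.contractibleSpace_compl_singleton_of_compl_image_ball hKball)))
      (HomotopySphere.nonempty_homotopyEquiv_sphere_of_isConnectedSum_of hKball))
    hS15

/-- **Theorem 1.1 for `Θₙ`, `n ≠ 0, 4`, from the current leaves, the contractibility of punctured
homotopy spheres replaced by the Whitehead–Hurewicz recognition principle**: (i)
`SPC4.nonemptyDiffeomorphSphere_of_mem` (spc4.S32; also supplies the dimensions `1, 2` of (iii')),
(iii'') `Manifold.contractibleSpace_of_simplyConnected_of_acyclic` (simply connected acyclic
manifolds are contractible: Bredon 1993, VII Cor. 10.11, Milnor 1959, Cor. 1; it gives (iii') by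
`HomotopySphere.contractibleSpace_compl_image_ball_of_facts`, `HomotopySpheresSumProofs.lean`),
(vii-a) `NullCobordism.exists_cobordism_sphere_compl_ball`, (vii-b)
`NullCobordism.isHomotopyEquiv_compl_ball_of_contractibleSpace`, (vii-c)
`HomotopySphere.exists_nullCobordism_isOrientedConnectedSum_neg` (Lemmas 2.3–2.4), (viii)
`SPC4.nonempty_diffeomorph_of_isHCobordant_of_five_le` (spc4.S15).
[cite: KervaireMilnorAnnals1963, Thm. 1.1, §2 pp. 504–507] -/
theorem exists_commGroup_homotopySphereClass_of_leaves'
    (hlow : FourManifolds.nonemptyDiffeomorphSphere_of_mem.{0})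
    (hW : Literature.AlgebraicTopology.Homotopy.Manifold.contractibleSpace_of_simplyConnected_of_acyclic.{0})
    (h23a : NullCobordism.exists_cobordism_sphere_compl_ball)
    (h23b : NullCobordism.isHomotopyEquiv_compl_ball_of_contractibleSpace)
    (h24a : HomotopySphere.exists_nullCobordism_isOrientedConnectedSum_neg)
    (hS15 : FourManifolds.nonempty_diffeomorph_of_isHCobordant_of_five_le.{0}) :
    exists_commGroup_homotopySphereClass :=
  exists_commGroup_homotopySphereClass_of_leaves hlow
    (HomotopySphere.contractibleSpace_compl_image_ball_of_facts hW hlow) h23a h23b h24a hS15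

end Literature.Topology.FourManifolds
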